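import Mathlib

/-!
# Finite Plancherel on `(ℤ/K)³` for the block characters of route `BlockLatticeFSum`
(decomp-a2c lens-6 g22; Mathlib only, no definitions, no `sorry`).

With `χ_q(B) = exp(2πi (Σ_j q_j B_j)/K)` for `q B : Fin 3 → Fin K` (the characters appearing verbatim in the
route decls `DeepInfraredEmptiness` / `ShellBudget` / `ShellModeCounting`):

* `sum_exp_eq` — `Σ_(t < K) exp(2πi t r/K) = K·[r = 0]` for `r ∈ ℤ`, `|r| < K`;
* `sum_chi_mul_conj_chi` — `Σ_q χ_q(B) conj(χ_q(B')) = K³·[B = B']`;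
* `plancherel` — `Σ_q ‖Σ_B conj(χ_q(B)) m_B‖² = K³ Σ_B ‖m_B‖²`, exactly the hypothesis `hPl` of
  `Kinematics.parseval_blockWaves`.
-/

namespace Summit.AtomisticToContinuum.BoseEinsteinCondensation.Theses.BlockLatticeFSum.Plancherel

open scoped BigOperators ComplexConjugate

/-- 1D orthogonality of the `K`-th roots of unity. -/
theorem sum_exp_eq {K : ℕ} (hK : 0 < K) (r : ℤ) (hr : |r| < K) :
    ∑ t : Fin K, Complex.exp (((2 * Real.pi * ((t : ℕ) : ℝ) * (r : ℝ) / (K : ℝ) : ℝ) : ℂ) * Complex.I)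
      = if r = 0 then (K : ℂ) else 0 := by
  have hKr : (K : ℝ) ≠ 0 := by exact_mod_cast hK.ne'
  split_ifs with h
  · subst h
    simp
  · set z : ℂ := Complex.exp (((2 * Real.pi * (r : ℝ) / (K : ℝ) : ℝ) : ℂ) * Complex.I) with hz
    have hterm : ∀ t : ℕ, Complex.exp (((2 * Real.pi * (t : ℝ) * (r : ℝ) / (K : ℝ) : ℝ) : ℂ) * Complex.I)
        = z ^ t := by
      intro t
      rw [hz, ← Complex.exp_nat_mul]
      congr 1
      push_cast
      ring
    rw [Fin.sum_univ_eq_sum_range (fun t => Complex.exp (((2 * Real.pi * (t : ℝ) * (r : ℝ) / (K : ℝ) : ℝ) : ℂ) * Complex.I)) K]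
    simp_rw [hterm]
    have hz1 : z ≠ 1 := by
      intro h1
      rw [hz, Complex.exp_eq_one_iff] at h1
      obtain ⟨m, hm⟩ := h1
      have hm' : (((2 * Real.pi * (r : ℝ) / (K : ℝ) : ℝ) : ℂ)) * Complex.I
          = (((m : ℝ) * (2 * Real.pi) : ℝ) : ℂ) * Complex.I := by
        rw [hm]; push_cast; ring
      have hreal : 2 * Real.pi * (r : ℝ) / (K : ℝ) = (m : ℝ) * (2 * Real.pi) :=
        Complex.ofReal_injective (mul_right_cancel₀ Complex.I_ne_zero hm')
      have hrm : (r : ℝ) = (m : ℝ) * (K : ℝ) := by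
        field_simp at hreal
        nlinarith [Real.pi_pos]
      have hrmZ : r = m * K := by exact_mod_cast hrm
      rcases eq_or_ne m 0 with hm0 | hm0
      · exact h (by rw [hrmZ, hm0, zero_mul])
      · have h1 : (1 : ℤ) ≤ |m| := Int.one_le_abs hm0
        have h2 : |r| = |m| * (K : ℤ) := by
          rw [hrmZ, abs_mul, abs_of_nonneg (show (0 : ℤ) ≤ (K : ℤ) from by positivity)]
        have : (K : ℤ) ≤ |r| := by rw [h2]; nlinarith
        omega
    have hzK : z ^ K = 1 := by
      rw [hz, ← Complex.exp_nat_mul]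
      have : ((K : ℕ) : ℂ) * ((((2 * Real.pi * (r : ℝ) / (K : ℝ) : ℝ) : ℂ)) * Complex.I)
          = (r : ℂ) * (2 * Real.pi * Complex.I) := by
        have hKc : (K : ℂ) ≠ 0 := by exact_mod_cast hK.ne'
        push_cast
        field_simp
      rw [this]
      exact_mod_cast Complex.exp_int_mul_two_pi_mul_I r
    rw [geom_sum_eq hz1, hzK, sub_self, zero_div]

/-- 3D orthogonality of the block characters: `Σ_q χ_q(B) conj(χ_q(B')) = K³·[B = B']`. -/
theorem sum_chi_mul_conj_chi {K : ℕ} (hK : 0 < K) (B B' : Fin 3 → Fin K) :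
    ∑ q : Fin 3 → Fin K,
      Complex.exp (((2 * Real.pi * (∑ j : Fin 3, ((q j : ℕ) : ℝ) * ((B j : ℕ) : ℝ)) / (K : ℝ) : ℝ) : ℂ) * Complex.I)
        * conj (Complex.exp (((2 * Real.pi * (∑ j : Fin 3, ((q j : ℕ) : ℝ) * ((B' j : ℕ) : ℝ)) / (K : ℝ) : ℝ) : ℂ) * Complex.I))
      = if B = B' then ((K : ℂ)) ^ 3 else 0 := by
  classical
  -- product form of the summand
  have hprod : ∀ q : Fin 3 → Fin K,
      Complex.exp (((2 * Real.pi * (∑ j : Fin 3, ((q j : ℕ) : ℝ) * ((B j : ℕ) : ℝ)) / (K : ℝ) : ℝ) : ℂ) * Complex.I)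
        * conj (Complex.exp (((2 * Real.pi * (∑ j : Fin 3, ((q j : ℕ) : ℝ) * ((B' j : ℕ) : ℝ)) / (K : ℝ) : ℝ) : ℂ) * Complex.I))
      = ∏ j : Fin 3, Complex.exp (((2 * Real.pi * ((q j : ℕ) : ℝ) *
          (((((B j : ℕ) : ℤ) - ((B' j : ℕ) : ℤ) : ℤ) : ℝ)) / (K : ℝ) : ℝ) : ℂ) * Complex.I) := by
    intro q
    rw [← Complex.exp_conj, ← Complex.exp_add, ← Complex.exp_sum]
    congr 1
    rw [map_mul, Complex.conj_ofReal, Complex.conj_I]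
    push_cast
    rw [Finset.mul_sum, Finset.mul_sum, Finset.sum_div, Finset.sum_div, Finset.sum_mul, Finset.sum_mul,
      ← Finset.sum_add_distrib]
    refine Finset.sum_congr rfl fun j _ => ?_
    ring
  simp_rw [hprod]
  rw [← Fintype.prod_sum (fun (j : Fin 3) (t : Fin K) => Complex.exp (((2 * Real.pi * ((t : ℕ) : ℝ) *
          (((((B j : ℕ) : ℤ) - ((B' j : ℕ) : ℤ) : ℤ) : ℝ)) / (K : ℝ) : ℝ) : ℂ) * Complex.I))]
  have hfac : ∀ j : Fin 3, ∑ t : Fin K, Complex.exp (((2 * Real.pi * ((t : ℕ) : ℝ) *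
          (((((B j : ℕ) : ℤ) - ((B' j : ℕ) : ℤ) : ℤ) : ℝ)) / (K : ℝ) : ℝ) : ℂ) * Complex.I)
      = if B j = B' j then (K : ℂ) else 0 := by
    intro j
    rw [sum_exp_eq hK]
    · congr 1
      simp only [sub_eq_zero, Int.natCast_inj, Fin.val_inj]
    · have h1 := (B j).isLt
      have h2 := (B' j).isLt
      rw [abs_lt]; constructor <;> omega
  simp_rw [hfac]
  split_ifs with hBB
  · subst hBB
    simp
  · obtain ⟨j, hj⟩ : ∃ j, B j ≠ B' j := by
      by_contra hcon
      push Not at hcon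
      exact hBB (funext hcon)
    exact Finset.prod_eq_zero (Finset.mem_univ j) (if_neg hj)

/-- FINITE PLANCHEREL for the block characters (the hypothesis `hPl` of `Kinematics.parseval_blockWaves`). -/
theorem plancherel {K : ℕ} (hK : 0 < K) (m : (Fin 3 → Fin K) → ℂ) :
    ∑ q : Fin 3 → Fin K, ‖∑ B : Fin 3 → Fin K,
        conj (Complex.exp (((2 * Real.pi * (∑ j : Fin 3, ((q j : ℕ) : ℝ) * ((B j : ℕ) : ℝ)) / (K : ℝ) : ℝ) : ℂ) * Complex.I)) * m B‖ ^ 2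
      = (K : ℝ) ^ 3 * ∑ B : Fin 3 → Fin K, ‖m B‖ ^ 2 := by
  classical
  have hsq : ∀ z : ℂ, ((‖z‖ : ℂ)) ^ 2 = conj z * z := fun z => (Complex.conj_mul' z).symm
  have main : ∑ q : Fin 3 → Fin K, conj (∑ B : Fin 3 → Fin K, conj (Complex.exp (((2 * Real.pi * (∑ j : Fin 3, ((q j : ℕ) : ℝ) * ((B j : ℕ) : ℝ)) / (K : ℝ) : ℝ) : ℂ) * Complex.I)) * m B)
        * (∑ B : Fin 3 → Fin K, conj (Complex.exp (((2 * Real.pi * (∑ j : Fin 3, ((q j : ℕ) : ℝ) * ((B j : ℕ) : ℝ)) / (K : ℝ) : ℝ) : ℂ) * Complex.I)) * m B)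
      = ((K : ℂ)) ^ 3 * ∑ B : Fin 3 → Fin K, conj (m B) * m B := by
    calc ∑ q : Fin 3 → Fin K, conj (∑ B : Fin 3 → Fin K, conj (Complex.exp (((2 * Real.pi * (∑ j : Fin 3, ((q j : ℕ) : ℝ) * ((B j : ℕ) : ℝ)) / (K : ℝ) : ℝ) : ℂ) * Complex.I)) * m B)
          * (∑ B : Fin 3 → Fin K, conj (Complex.exp (((2 * Real.pi * (∑ j : Fin 3, ((q j : ℕ) : ℝ) * ((B j : ℕ) : ℝ)) / (K : ℝ) : ℝ) : ℂ) * Complex.I)) * m B)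
        = ∑ q : Fin 3 → Fin K, ∑ B : Fin 3 → Fin K, ∑ B' : Fin 3 → Fin K,
            conj (m B) * m B' * (Complex.exp (((2 * Real.pi * (∑ j : Fin 3, ((q j : ℕ) : ℝ) * ((B j : ℕ) : ℝ)) / (K : ℝ) : ℝ) : ℂ) * Complex.I) * conj (Complex.exp (((2 * Real.pi * (∑ j : Fin 3, ((q j : ℕ) : ℝ) * ((B' j : ℕ) : ℝ)) / (K : ℝ) : ℝ) : ℂ) * Complex.I))) := by
          refine Finset.sum_congr rfl fun q _ => ?_
          rw [map_sum, Finset.sum_mul]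
          refine Finset.sum_congr rfl fun B _ => ?_
          rw [map_mul, Complex.conj_conj, Finset.mul_sum]
          refine Finset.sum_congr rfl fun B' _ => ?_
          ring
      _ = ∑ B : Fin 3 → Fin K, ∑ B' : Fin 3 → Fin K, conj (m B) * m B' *
            ∑ q : Fin 3 → Fin K, Complex.exp (((2 * Real.pi * (∑ j : Fin 3, ((q j : ℕ) : ℝ) * ((B j : ℕ) : ℝ)) / (K : ℝ) : ℝ) : ℂ) * Complex.I) * conj (Complex.exp (((2 * Real.pi * (∑ j : Fin 3, ((q j : ℕ) : ℝ) * ((B' j : ℕ) : ℝ)) / (K : ℝ) : ℝ) : ℂ) * Complex.I)) := by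
          rw [Finset.sum_comm]
          refine Finset.sum_congr rfl fun B _ => ?_
          rw [Finset.sum_comm]
          refine Finset.sum_congr rfl fun B' _ => ?_
          rw [Finset.mul_sum]
      _ = ∑ B : Fin 3 → Fin K, ∑ B' : Fin 3 → Fin K, conj (m B) * m B' *
            (if B = B' then ((K : ℂ)) ^ 3 else 0) := by
          refine Finset.sum_congr rfl fun B _ => Finset.sum_congr rfl fun B' _ => ?_
          rw [sum_chi_mul_conj_chi hK B B']
      _ = ∑ B : Fin 3 → Fin K, conj (m B) * m B * ((K : ℂ)) ^ 3 := by
          refine Finset.sum_congr rfl fun B _ => ?_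
          simp_rw [mul_ite, mul_zero]
          rw [Finset.sum_ite_eq]
          simp
      _ = ((K : ℂ)) ^ 3 * ∑ B : Fin 3 → Fin K, conj (m B) * m B := by
          rw [Finset.mul_sum]
          refine Finset.sum_congr rfl fun B _ => ?_
          ring
  apply Complex.ofReal_injective
  rw [Complex.ofReal_sum, Complex.ofReal_mul, Complex.ofReal_pow, Complex.ofReal_natCast,
    Complex.ofReal_sum]
  simp_rw [Complex.ofReal_pow, hsq]
  exact main

end Summit.AtomisticToContinuum.BoseEinsteinCondensation.Theses.BlockLatticeFSum.Plancherel
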